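import Summits.ValiantsHypothesis.ValiantsHypothesis.Theorems.KPlusLogSqLawTropicalBSymmetricOrbits

/-!
# Route `KPlusLogSqLaw`, crux `TropicalB` — designs with a GROUP of symmetries: few dominant permutations

HONEST FRAMING.  Helper toward the registered stubs `stub_tropThin` / `stub_tropFat` of
`Cruxes/TropicalB/Lines/birth.lean` (crux `Summit.ValiantsHypothesis.ValiantsHypothesis.Theses.KPlusLogSqLaw.TropicalB`,
ledger item `stmt-ValiantsHypothesis-19771`, route `KPlusLogSqLaw`; cell `pub-symmetroid`, seat `val-sym-trop-p3`,
2026-08-26; desk docket D1a′).  The GROUP form of `…TropicalBSymmetricOrbits` (this seat, p426340: one relabelling pair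
and its powers).  A SECTOR theorem of an OPEN conjecture on an OBJECT-SYMMETRY class (measure zero among designs);
nothing here bounds `TropicalB` for general designs — there the visited-permutation law is the crux itself — and nothing
bears on `KPlusLogSqLaw`, `MatrixDescartes` or `VP ≠ VNP`.

Let `gens` be any set of relabelling pairs `(α, β) ∈ Perm (Fin m) × Perm (Fin m)` preserving a design
(`v (α a) (β b) l = v a b l`, `ε (α a) (β b) l = ε a b l`).  Then every element `g` of the subgroup `Subgroup.closure gens`
of `Perm × Perm` preserves the design (`preserves_of_mem_closure`), so every dominant term is `g`-fixed (val-sym-trop-p2's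
`isDominant_fixed_of_symmetry'`), and a fixed term is determined by its restriction to any set `T` of columns meeting
every orbit of the closure acting on columns:

* `card_le_pow_of_symmetryGroup` / `chain_succ_le_pow_of_symmetryGroup` / `designRowD_of_symmetryGroup` :
  `n + 1 ≤ m^|T| · K^|T|` for every injective family of dominant terms / sign-alternating chain / unsigned row;
* `symmetryGroup_kPlusLogSq_adaptive` : `|T|·(log₂ m + 1) ≤ K + log₂² m` ⇒ the crux's inequality with `C = 2`;
* TRANSITIVE symmetry groups (`T = {t₀}`): `chain_succ_le_of_transitiveSymmetry : n + 1 ≤ m·K` — a design with a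
  transitive group of relabelling-pair symmetries has at most `m·K` dominant terms in total (cyclic: val-sym-trop-p2's
  circulant sector, where `n ≤ K − 1`; torus translations `ℤ_{m₁} × ℤ_{m₂}`, affine groups, …), and
  `transitiveSymmetry_kPlusLogSq : n ≤ 2^(2·(K + log₂² m))`.

[folklore: uniqueness of an optimum ⇒ invariance under the automorphism group; orbit counting]
-/

set_option linter.dupNamespace false
set_option autoImplicit false

namespace Summit.ValiantsHypothesis.ValiantsHypothesis.Theorems.KPlusLogSqLaw

open Summit.ValiantsHypothesis.ValiantsHypothesis.Theorems.MatrixDescartes.Negative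
open Summit.ValiantsHypothesis.ValiantsHypothesis.Theorems.LacunarySymmetroidMatrixDescartes
open Summit.ValiantsHypothesis.ValiantsHypothesis.Theorems.LacunarySymmetroidMatrixDescartes.TropicalCensus
open scoped BigOperators
open Finset

section SymmetryGroup

variable {m K : ℕ}

/-- **The symmetries of a design form a group**: every element of the subgroup generated by relabelling pairs preserving
`(v, ε)` preserves `(v, ε)`. [folklore] -/
theorem preserves_of_mem_closure (v ε : Fin m → Fin m → Fin K → ℤ)
    (gens : Set (Equiv.Perm (Fin m) × Equiv.Perm (Fin m)))
    (hgen : ∀ g ∈ gens, (∀ a b l, v (g.1 a) (g.2 b) l = v a b l) ∧ (∀ a b l, ε (g.1 a) (g.2 b) l = ε a b l))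
    {g : Equiv.Perm (Fin m) × Equiv.Perm (Fin m)} (hg : g ∈ Subgroup.closure gens) :
    (∀ a b l, v (g.1 a) (g.2 b) l = v a b l) ∧ (∀ a b l, ε (g.1 a) (g.2 b) l = ε a b l) := by
  induction hg using Subgroup.closure_induction with
  | mem x hx => exact hgen x hx
  | one => exact ⟨fun _ _ _ => rfl, fun _ _ _ => rfl⟩
  | mul x y _ _ ihx ihy =>
    refine ⟨fun a b l => ?_, fun a b l => ?_⟩
    · rw [Prod.fst_mul, Prod.snd_mul, Equiv.Perm.mul_apply, Equiv.Perm.mul_apply, ihx.1, ihy.1]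
    · rw [Prod.fst_mul, Prod.snd_mul, Equiv.Perm.mul_apply, Equiv.Perm.mul_apply, ihx.2, ihy.2]
  | inv x _ ihx =>
    refine ⟨fun a b l => ?_, fun a b l => ?_⟩
    · have := ihx.1 (x.1⁻¹ a) (x.2⁻¹ b) l
      simp only [Prod.fst_inv, Prod.snd_inv, Equiv.Perm.coe_inv, Equiv.apply_symm_apply] at this ⊢
      exact this.symm
    · have := ihx.2 (x.1⁻¹ a) (x.2⁻¹ b) l
      simp only [Prod.fst_inv, Prod.snd_inv, Equiv.Perm.coe_inv, Equiv.apply_symm_apply] at this ⊢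
      exact this.symm

/-- a term fixed by `(α, β)` transports values along `β`: `σ (β t) = α (σ t)`. [folklore] -/
theorem apply_of_fixed (α β σ : Equiv.Perm (Fin m)) (h : α * σ * β⁻¹ = σ) (t : Fin m) : σ (β t) = α (σ t) := by
  simpa using apply_pow_of_fixed α β σ h 1 t

/-- a class map fixed by `β` is constant along `β`: `λ (β t) = λ t`. [folklore] -/
theorem class_of_fixed (β : Equiv.Perm (Fin m)) (μ : Fin m → Fin K) (h : (fun j => μ (β.symm j)) = μ) (t : Fin m) :
    μ (β t) = μ t := by
  simpa using class_pow_of_fixed β μ h 1 t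

/-- **Few dominant terms under a group of symmetries (core).**  If every pair in `gens` preserves the design and `T`
meets every orbit of `Subgroup.closure gens` acting on the columns, every injective family of dominant terms indexed by
`Fin (n+1)` has `n + 1 ≤ m^|T| · K^|T|`. [folklore] -/
theorem card_le_pow_of_symmetryGroup (d : Fin K → ℕ) (v ε : Fin m → Fin m → Fin K → ℤ)
    (gens : Set (Equiv.Perm (Fin m) × Equiv.Perm (Fin m)))
    (hgen : ∀ g ∈ gens, (∀ a b l, v (g.1 a) (g.2 b) l = v a b l) ∧ (∀ a b l, ε (g.1 a) (g.2 b) l = ε a b l))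
    (T : Finset (Fin m)) (hT : ∀ b : Fin m, ∃ t ∈ T, ∃ g ∈ Subgroup.closure gens, g.2 t = b)
    {n : ℕ} (θ : Fin (n + 1) → ℤ) (p : Fin (n + 1) → Equiv.Perm (Fin m) × (Fin m → Fin K))
    (hdom : ∀ k, IsDominant d v ε (θ k) (p k)) (hinj : Function.Injective p) :
    n + 1 ≤ m ^ T.card * K ^ T.card := by
  classical
  have hfix : ∀ k, ∀ g ∈ Subgroup.closure gens,
      g.1 * (p k).1 * g.2⁻¹ = (p k).1 ∧ (fun j => (p k).2 (g.2.symm j)) = (p k).2 := by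
    intro k g hg
    obtain ⟨hv, hε⟩ := preserves_of_mem_closure v ε gens hgen hg
    exact isDominant_fixed_of_symmetry' d v ε g.1 g.2 hv hε (θ k) (p k).1 (p k).2 (hdom k)
  let F : Fin (n + 1) → (T → Fin m) × (T → Fin K) := fun k => (fun t => (p k).1 t, fun t => (p k).2 t)
  have hF : Function.Injective F := by
    intro k k' hkk
    have h1 : ∀ t ∈ T, (p k).1 t = (p k').1 t := fun t ht => by
      have := congrArg (fun G : (T → Fin m) × (T → Fin K) => G.1 ⟨t, ht⟩) hkk
      simpa [F] using this
    have h2 : ∀ t ∈ T, (p k).2 t = (p k').2 t := fun t ht => by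
      have := congrArg (fun G : (T → Fin m) × (T → Fin K) => G.2 ⟨t, ht⟩) hkk
      simpa [F] using this
    apply hinj
    refine Prod.ext (Equiv.ext fun b => ?_) (funext fun b => ?_)
    · obtain ⟨t, ht, g, hg, rfl⟩ := hT b
      rw [apply_of_fixed g.1 g.2 _ (hfix k g hg).1, apply_of_fixed g.1 g.2 _ (hfix k' g hg).1, h1 t ht]
    · obtain ⟨t, ht, g, hg, rfl⟩ := hT b
      rw [class_of_fixed g.2 _ (hfix k g hg).2, class_of_fixed g.2 _ (hfix k' g hg).2, h2 t ht]
  have hcard := Fintype.card_le_of_injective F hF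
  simpa [Fintype.card_fin, Fintype.card_prod, Fintype.card_fun, Fintype.card_coe] using hcard

/-- **Signed chains**: `n + 1 ≤ m^|T| · K^|T|` along every sign-alternating dominant chain of a design with a group of
symmetries whose column orbits are met by `T`. [folklore] -/
theorem chain_succ_le_pow_of_symmetryGroup (d : Fin K → ℕ) (v ε : Fin m → Fin m → Fin K → ℤ)
    (gens : Set (Equiv.Perm (Fin m) × Equiv.Perm (Fin m)))
    (hgen : ∀ g ∈ gens, (∀ a b l, v (g.1 a) (g.2 b) l = v a b l) ∧ (∀ a b l, ε (g.1 a) (g.2 b) l = ε a b l))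
    (T : Finset (Fin m)) (hT : ∀ b : Fin m, ∃ t ∈ T, ∃ g ∈ Subgroup.closure gens, g.2 t = b)
    {n : ℕ} (θ : Fin (n + 1) → ℤ) (p : Fin (n + 1) → Equiv.Perm (Fin m) × (Fin m → Fin K))
    (hθ : StrictMono θ) (hdom : ∀ k, IsDominant d v ε (θ k) (p k))
    (halt : ∀ k : Fin n, termSign ε (p k.castSucc) * termSign ε (p k.succ) < 0) :
    n + 1 ≤ m ^ T.card * K ^ T.card :=
  card_le_pow_of_symmetryGroup d v ε gens hgen T hT θ p hdom (stub_dominantInjective m K d v ε n θ p hθ hdom halt)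

/-- **Unsigned row**: `DesignRowD d v ε (m^|T| · K^|T| − 1)` for a design with such a group of symmetries. [folklore] -/
theorem designRowD_of_symmetryGroup (d : Fin K → ℕ) (v ε : Fin m → Fin m → Fin K → ℤ)
    (gens : Set (Equiv.Perm (Fin m) × Equiv.Perm (Fin m)))
    (hgen : ∀ g ∈ gens, (∀ a b l, v (g.1 a) (g.2 b) l = v a b l) ∧ (∀ a b l, ε (g.1 a) (g.2 b) l = ε a b l))
    (T : Finset (Fin m)) (hT : ∀ b : Fin m, ∃ t ∈ T, ∃ g ∈ Subgroup.closure gens, g.2 t = b) :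
    DesignRowD d v ε (m ^ T.card * K ^ T.card - 1) := by
  intro n θ p hθ hdom hne
  have := card_le_pow_of_symmetryGroup d v ε gens hgen T hT θ p hdom (injective_of_chainD d v ε θ p hθ hdom hne)
  omega

/-- **K-adaptive `K + log² m` law for designs with a group of symmetries** (`C = 2` whenever
`|T|·(log₂ m + 1) ≤ K + log₂² m`). [folklore] -/
theorem symmetryGroup_kPlusLogSq_adaptive (d : Fin K → ℕ) (v ε : Fin m → Fin m → Fin K → ℤ)
    (gens : Set (Equiv.Perm (Fin m) × Equiv.Perm (Fin m)))
    (hgen : ∀ g ∈ gens, (∀ a b l, v (g.1 a) (g.2 b) l = v a b l) ∧ (∀ a b l, ε (g.1 a) (g.2 b) l = ε a b l))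
    (T : Finset (Fin m)) (hT : ∀ b : Fin m, ∃ t ∈ T, ∃ g ∈ Subgroup.closure gens, g.2 t = b)
    (hTcard : T.card * (Nat.log 2 m + 1) ≤ K + Nat.log 2 m ^ 2) (hε1 : ∀ i j l, (ε i j l).natAbs ≤ 1)
    {n : ℕ} (θ : Fin (n + 1) → ℤ) (p : Fin (n + 1) → Equiv.Perm (Fin m) × (Fin m → Fin K))
    (hθ : StrictMono θ) (hdom : ∀ k, IsDominant d v ε (θ k) (p k))
    (halt : ∀ k : Fin n, termSign ε (p k.castSucc) * termSign ε (p k.succ) < 0) :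
    n ≤ 2 ^ (2 * (K + Nat.log 2 m ^ 2)) := by
  rcases le_or_gt K m with hK | hK
  · have h1 := chain_succ_le_pow_of_symmetryGroup d v ε gens hgen T hT θ p hθ hdom halt
    have h2 := pow_mul_pow_le_two_pow_adaptive m K T.card hTcard hK
    omega
  · have h := tropRootLawAt_fatEnd (m := m) (K := K) hK.le d v ε n θ p hε1 hθ hdom halt
    exact h.trans (Nat.pow_le_pow_right (by norm_num) (by nlinarith))

/-- **Transitive symmetry groups: at most `m·K` dominant terms.**  If relabelling pairs preserving the design generate a
group acting transitively on the columns, every sign-alternating dominant chain has `n + 1 ≤ m·K` (cyclic: the circulant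
sector; torus translations; any transitive group). [folklore] -/
theorem chain_succ_le_of_transitiveSymmetry (d : Fin K → ℕ) (v ε : Fin m → Fin m → Fin K → ℤ)
    (gens : Set (Equiv.Perm (Fin m) × Equiv.Perm (Fin m)))
    (hgen : ∀ g ∈ gens, (∀ a b l, v (g.1 a) (g.2 b) l = v a b l) ∧ (∀ a b l, ε (g.1 a) (g.2 b) l = ε a b l))
    (t₀ : Fin m) (htrans : ∀ b : Fin m, ∃ g ∈ Subgroup.closure gens, g.2 t₀ = b)
    {n : ℕ} (θ : Fin (n + 1) → ℤ) (p : Fin (n + 1) → Equiv.Perm (Fin m) × (Fin m → Fin K))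
    (hθ : StrictMono θ) (hdom : ∀ k, IsDominant d v ε (θ k) (p k))
    (halt : ∀ k : Fin n, termSign ε (p k.castSucc) * termSign ε (p k.succ) < 0) :
    n + 1 ≤ m * K := by
  classical
  have h := chain_succ_le_pow_of_symmetryGroup d v ε gens hgen {t₀}
    (fun b => ⟨t₀, mem_singleton_self _, htrans b⟩) θ p hθ hdom halt
  simpa using h

/-- **Transitive symmetry groups: the `K + log² m` law with `C = 2`.** [folklore] -/
theorem transitiveSymmetry_kPlusLogSq (d : Fin K → ℕ) (v ε : Fin m → Fin m → Fin K → ℤ)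
    (gens : Set (Equiv.Perm (Fin m) × Equiv.Perm (Fin m)))
    (hgen : ∀ g ∈ gens, (∀ a b l, v (g.1 a) (g.2 b) l = v a b l) ∧ (∀ a b l, ε (g.1 a) (g.2 b) l = ε a b l))
    (t₀ : Fin m) (htrans : ∀ b : Fin m, ∃ g ∈ Subgroup.closure gens, g.2 t₀ = b)
    (hε1 : ∀ i j l, (ε i j l).natAbs ≤ 1)
    {n : ℕ} (θ : Fin (n + 1) → ℤ) (p : Fin (n + 1) → Equiv.Perm (Fin m) × (Fin m → Fin K))
    (hθ : StrictMono θ) (hdom : ∀ k, IsDominant d v ε (θ k) (p k))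
    (halt : ∀ k : Fin n, termSign ε (p k.castSucc) * termSign ε (p k.succ) < 0) :
    n ≤ 2 ^ (2 * (K + Nat.log 2 m ^ 2)) := by
  classical
  rcases Nat.eq_zero_or_pos K with hK0 | hK0
  · -- no class: the chain is a single term
    subst hK0
    have hn : n ≤ 0 := tropRootLawAt_zero m 0 d v ε n θ p hε1 hθ hdom halt
    exact hn.trans (Nat.zero_le _)
  refine symmetryGroup_kPlusLogSq_adaptive d v ε gens hgen {t₀} (fun b => ⟨t₀, mem_singleton_self _, htrans b⟩)
    ?_ hε1 θ p hθ hdom halt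
  rw [card_singleton, one_mul]
  have : Nat.log 2 m ≤ Nat.log 2 m ^ 2 := by nlinarith
  omega

end SymmetryGroup

end Summit.ValiantsHypothesis.ValiantsHypothesis.Theorems.KPlusLogSqLaw
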